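import Mathlib
import HarnessLib

/-!
# Rational points on `y² = x^p − ℓ` and `y² = x^p − 2ℓ` for large `p` with `(2/p) = −1`
# (Freitas–Kraus 2022, §3 — the symplectic extension of Ivorra–Kraus 2006)

Topic `Literature/NumberTheory/DiophantineGeometry`, signature-`(p, p, 2)` shelf (see
`GeneralizedFermatNN2TwoPowerPrimePower.lean` = Ivorra–Kraus 2006, whose bound `f(ℓ)` and whose equation
`x^p + ℓ y^p = z²` these results refine on the branch `y = −v²`).

Source: N. Freitas, A. Kraus, *On the symplectic type of isomorphisms of the `p`-torsion of elliptic curves*,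
Mem. Amer. Math. Soc. 277 (2022), no. 1361 [FreitasKraus2022]; HELD as arXiv:1607.01218 (v5), whose §3 "On the
hyperelliptic curves `y² = x^p − ℓ` and `y² = x^p − 2ℓ`" carries the two theorems below as Theorem 20 (§3.1) and
Theorem 23 (§3.2) — the Memoirs numbering differs (authors' arXiv comment; bib note), so the cites name the
section and the curve.

Printed text (arXiv v5 §3, verbatim): "In this section, we consider the family of curves
`C_{ℓ,p} : y² = x^p − ℓ` and `C'_{ℓ,p} : y² = x^p − 2ℓ` where `ℓ` and `p` are primes. Let us define the quantity
`f(ℓ) = (√(32(ℓ+1)) + 1)^{8(ℓ−1)}`. From [IK2006], we know that, if `ℓ ≡ 3 (mod 8)` and `ℓ ≠ 3`, or if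
`ℓ ≡ 5 (mod 8)` and `ℓ − 1` is not a square, then for all primes `p > f(ℓ)` there are no rational points on the
curve `C_{ℓ,p}`. Furthermore, if `ℓ ≡ 3 (mod 8)` and `ℓ − 2` is not a square, we have the same conclusion for the
set `C'_{ℓ,p}(ℚ)`. Our objective in this section is to use the symplectic argument to extend these results.
§3.1 … **Theorem.** Let `ℓ ≡ 5 (mod 8)` be a prime such that `ℓ − 1` is a square. Then, for all primes `p > f(ℓ)`
satisfying `(2/p) = −1`, the set `C_{ℓ,p}(ℚ)` is empty. Note that, from the assumptions made on `ℓ`, we have `ℓ = 5`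
or `ℓ ≥ 29`. … §3.2 We assume in this section `ℓ ≥ 29` and we show the following result. **Theorem.** Let
`ℓ ≡ 3 (mod 8)` be a prime such that `ℓ − 2` is a square. Then, for all primes `p > f(ℓ)` satisfying `(2/p) = −1`,
the set `C'_{ℓ,p}(ℚ)` is empty."

Rendering notes. (i) `(2/p) = −1` for an odd prime `p` is stated as `p ≡ 3` or `5 (mod 8)` (`TwoIsNonResidue`);
the equivalence with Mathlib's `legendreSym p 2 = −1` is PROVED (`twoIsNonResidue_iff`). (ii) `f(ℓ)` is the real
number `(√(32(ℓ+1)) + 1)^{8(ℓ−1)}` exactly as printed (`fBound`), the same bound as (3) of [IvorraKraus2006, Thm 1.1].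
(iii) "`C(ℚ)` is empty" (affine model; the curves have one point at infinity, which is not an affine solution) ↦
`∀ x y : ℚ, y² ≠ x^p − ℓ`. (iv) §3.2's standing assumption `ℓ ≥ 29` is kept as a hypothesis of the second fact.

Why vendored (venture cell `pub-abcsig`, lit seat g5, 2026-08-23): three signed census cells of the cell
(`xⁿ + ℓ^m yⁿ = z²`-type rows at `ℓ ∈ {101, 197, …}`, `ℓ ≡ 5 (mod 8)` with `ℓ − 1` a square, where [IK06, Thm 1.1]
case (3)(iii) FAILS) cite "[FK22, Thm 20]" as the NEAREST PARTIAL printed result ("the `y = −□` branch of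
`S_p(1, ℓ, 1)`", `run/shared/lean/pub/pub-abcsig/lit/C2A-R2-PERCELL.md`). The bridge from the curve to that branch
(the paper's own first step, `x = u/v²`, `y = w/v^p`) is PROVED below (`ratPoints_xPowSubEll.no_negSquare_branch`).
No discharge is attempted (modular method + the symplectic criteria of the Memoir).
-/

namespace Literature.NumberTheory.DiophantineGeometry

namespace FreitasKraus2022

/-- `f(ℓ) = (√(32(ℓ+1)) + 1)^{8(ℓ−1)}` (§3, verbatim in the module docstring; = bound (3) of
[IvorraKraus2006, Thm 1.1]). [cite: FreitasKraus2022, §3 (definition of f(ℓ); arXiv:1607.01218v5)] -/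
noncomputable def fBound (ℓ : ℕ) : ℝ := (Real.sqrt (32 * ((ℓ : ℝ) + 1)) + 1) ^ (8 * (ℓ - 1))

/-- "`(2/p) = −1`" for an odd prime `p`, i.e. `2` is a quadratic non-residue mod `p`, stated elementarily as
`p ≡ 3` or `5 (mod 8)` (second supplement to quadratic reciprocity; `twoIsNonResidue_iff`).
[cite: FreitasKraus2022, §3.1 (hypothesis (2/p) = −1)] -/
def TwoIsNonResidue (p : ℕ) : Prop := p % 8 = 3 ∨ p % 8 = 5

/-- **Freitas–Kraus 2022, §3.1, Theorem on `C_{ℓ,p} : y² = x^p − ℓ`** (Thm 20 of arXiv:1607.01218v5), as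
printed modulo rendering notes (i)–(iii): let `ℓ ≡ 5 (mod 8)` be a prime with `ℓ − 1` a square; then for every
prime `p > f(ℓ)` with `(2/p) = −1` there are no `x, y ∈ ℚ` with `y² = x^p − ℓ`.
[cite: FreitasKraus2022, §3.1 Theorem (C_{ℓ,p}(ℚ) = ∅; Thm 20 of arXiv:1607.01218v5)] -/
def ratPoints_xPowSubEll : Prop :=
  ∀ ℓ : ℕ, ℓ.Prime → ℓ % 8 = 5 → IsSquare (ℓ - 1) →
    ∀ p : ℕ, p.Prime → fBound ℓ < p → TwoIsNonResidue p →
      ∀ x y : ℚ, y ^ 2 ≠ x ^ p - ℓ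

/-- **Freitas–Kraus 2022, §3.2, Theorem on `C'_{ℓ,p} : y² = x^p − 2ℓ`** (Thm 23 of arXiv:1607.01218v5), as
printed modulo rendering notes (i)–(iv): let `ℓ ≥ 29`, `ℓ ≡ 3 (mod 8)` be a prime with `ℓ − 2` a square; then
for every prime `p > f(ℓ)` with `(2/p) = −1` there are no `x, y ∈ ℚ` with `y² = x^p − 2ℓ`.
[cite: FreitasKraus2022, §3.2 Theorem (C'_{ℓ,p}(ℚ) = ∅; Thm 23 of arXiv:1607.01218v5)] -/
def ratPoints_xPowSubTwoEll : Prop :=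
  ∀ ℓ : ℕ, ℓ.Prime → 29 ≤ ℓ → ℓ % 8 = 3 → IsSquare (ℓ - 2) →
    ∀ p : ℕ, p.Prime → fBound ℓ < p → TwoIsNonResidue p →
      ∀ x y : ℚ, y ^ 2 ≠ x ^ p - 2 * ℓ

/-- Rendering note (i) is faithful: for an odd prime `p`, `p ≡ 3, 5 (mod 8)` iff the Legendre symbol
`(2/p) = −1` (Mathlib: `legendreSym.at_two`, `ZMod.χ₈_nat_eq_if_mod_eight`).
[cite: FreitasKraus2022, §3.1 (hypothesis (2/p) = −1, equivalence with the elementary form)] -/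
theorem twoIsNonResidue_iff {p : ℕ} [Fact p.Prime] (hp : p ≠ 2) :
    TwoIsNonResidue p ↔ legendreSym p 2 = -1 := by
  have hodd : p % 2 = 1 := Nat.odd_iff.mp ((Fact.out : p.Prime).odd_of_ne_two hp)
  have h8 := ZMod.χ₈_nat_eq_if_mod_eight p
  rw [legendreSym.at_two hp]
  unfold TwoIsNonResidue
  constructor
  · intro h
    rw [h8, if_neg (by omega), if_neg (by omega)]
  · intro h
    rw [h8, if_neg (by omega)] at h
    by_contra hne
    rw [if_pos (by omega)] at h
    exact absurd h (by decide)

/-- The hypotheses at the cells that cite the §3.1 theorem (`ℓ ∈ {5, 101, 197}`: `ℓ ≡ 5 (mod 8)`, `ℓ − 1 = 2², 10²,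
14²`) and at one `ℓ` of the §3.2 kind (`ℓ = 83 ≡ 3 (mod 8)`, `83 − 2 = 9²`, `83 ≥ 29`).
[cite: FreitasKraus2022, §3.1/§3.2 (hypothesis instances ℓ = 5, 101, 197, 83)] -/
theorem hypothesis_instances :
    (5 % 8 = 5 ∧ IsSquare (5 - 1 : ℕ)) ∧ (101 % 8 = 5 ∧ IsSquare (101 - 1 : ℕ)) ∧
      (197 % 8 = 5 ∧ IsSquare (197 - 1 : ℕ)) ∧ (29 ≤ 83 ∧ 83 % 8 = 3 ∧ IsSquare (83 - 2 : ℕ)) := by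
  refine ⟨⟨by norm_num, ⟨2, by norm_num⟩⟩, ⟨by norm_num, ⟨10, by norm_num⟩⟩, ⟨by norm_num, ⟨14, by norm_num⟩⟩,
    ⟨by norm_num, by norm_num, ⟨9, by norm_num⟩⟩⟩

/-- The paper's first step, PROVED: a solution of `u^p + ℓ(−v²)^p = w²` in integers with `v ≠ 0` gives the
rational point `(u/v², w/v^p)` on `C_{ℓ,p}` (for odd `p`). Hence the §3.1 theorem empties the "`y = −□`" branch of
Ivorra–Kraus's `S_p(1, ℓ, 1)` — the form in which the census rows cite it.
[cite: FreitasKraus2022, §3.1 (reduction (u, −v², w) ↦ (u/v², w/v^p), eq. following Thm 20)] -/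
theorem ratPoints_xPowSubEll.no_negSquare_branch (h : ratPoints_xPowSubEll) {ℓ p : ℕ} (hℓ : ℓ.Prime)
    (h5 : ℓ % 8 = 5) (hsq : IsSquare (ℓ - 1)) (hp : p.Prime) (hf : fBound ℓ < p) (h2 : TwoIsNonResidue p)
    {u v w : ℤ} (hv : v ≠ 0) (heq : u ^ p + (ℓ : ℤ) * (-v ^ 2) ^ p = w ^ 2) : False := by
  have hp2 : p ≠ 2 := by rintro rfl; unfold TwoIsNonResidue at h2; omega
  have hodd : Odd p := hp.odd_of_ne_two hp2
  apply h ℓ hℓ h5 hsq p hp hf h2 ((u : ℚ) / (v : ℚ) ^ 2) ((w : ℚ) / (v : ℚ) ^ p)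
  have hv' : (v : ℚ) ≠ 0 := by exact_mod_cast hv
  have heq' : ((u : ℚ)) ^ p + (ℓ : ℚ) * (-(v : ℚ) ^ 2) ^ p = (w : ℚ) ^ 2 := by exact_mod_cast heq
  rw [hodd.neg_pow] at heq'
  have key : ((w : ℚ)) ^ 2 = (u : ℚ) ^ p - (ℓ : ℚ) * ((v : ℚ) ^ 2) ^ p := by linear_combination heq'.symm
  rw [div_pow, div_pow, key, ← pow_mul, ← pow_mul, mul_comm p 2]
  field_simp

end FreitasKraus2022

end Literature.NumberTheory.DiophantineGeometry
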